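import Literature.MathematicalPhysics.QuantumLattice.WightmanPermutedTubeReach
import Literature.MathematicalPhysics.QuantumLattice.WightmanTubeInvariance
import HarnessLib

/-!
# The symmetric continuation: the global step in four space-time dimensions (Tomozawa 1963)

Topic `Literature/MathematicalPhysics/QuantumLattice` (trunk T-AQFT), companion of
`WightmanPermutedTubeReach.lean`, in the decomposition of the named fact (K)
`IsWightmanQFT.extendedTube_continuation_perm_eq` (`WightmanPermutedTube`): the Bargmann–Hall–Wightman
continuation `𝔚` of the `n`-point Wightman function of one scalar field satisfies
`𝔚(z ∘ σ) = 𝔚(z)` whenever `z` and `z ∘ σ` lie in the extended tube `𝒯'ₙ = relExtendedTube d n`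
(Osterwalder–Schrader I, §5 p. 97: "analytic, single valued, symmetric … for `(z₁, …, zₙ) ∈ S'ₙ`,
see [Jost (1965)], p. 83"). After `WightmanLocality`, `WightmanPermutedTubeLocal` and
`WightmanPermutedTubeReach` (Streater–Wightman Thm. 3-2 (d), Thm. 3-6, §2-4 Fig. 2-4) the fact is
reduced to the purely geometric condition `PermReachable d n` on `𝒯'ₙ ∩ σ𝒯'ₙ`. This file records
the printed theorem that settles that condition in four space-time dimensions and assembles:

* `permSlice d n σ = {w ∈ 𝒯ʳₙ | w ∘ σ ∈ 𝒯'ₙ}`, the trace of `σ𝒯'ₙ` on the relative tube, and the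
  **proved** reductions `permReachable_of_isPreconnected_permSlice` (reachability follows from the
  preconnectedness of these slices and the existence of common real points: every
  `z ∈ 𝒯'ₙ ∩ σ𝒯'ₙ` is `Λ₀w₀` with `w₀` in the slice, and `Λ₀ · permSlice` is a preconnected subset
  of `𝒯'ₙ ∩ σ𝒯'ₙ` through `z` meeting the `L₊(ℂ)`-orbit of any common real point) and
  `permReachable_of_isPreconnected_inter` (a fortiori from the preconnectedness of
  `𝒯'ₙ ∩ σ𝒯'ₙ` itself), both in general dimension;
* (T) `isConnected_relExtendedTube_inter_perm` (**named fact**; Tomozawa (1963): "the extended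
  tubes, the union of them and the intersection of any two are simply connected", for the
  permuted extended tubes of the `n`-point function in four-dimensional space-time): for `d = 3`,
  every `𝒯'ₙ ∩ σ𝒯'ₙ` is connected;
* `permReachable_three` (**proved**): (T) and the common real points of S–W Fig. 2-4
  (`exists_real_mem_relExtendedTube_perm`) give `PermReachable 3 n` for all `n`;
* (K₄) `IsWightmanQFT.extendedTube_continuation_perm_eq_dim4` (**named fact**, the statement (K)
  in the printed scope `d = 3`) and `IsWightmanQFT.extendedTube_continuation_perm_eq_dim4_of_isConnected`
  (**proved**): (T) implies (K₄); hence (`IsWightmanQFT.exists_symmetric_continuation_dim4_of_isConnected`,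
  `IsWickRotationOf.schwinger_symmetric_dim4_of_isConnected`) the symmetric continuation and the
  symmetry of the Schwinger functions in four dimensions follow from the Bargmann–Hall–Wightman
  continuation (A) and (T).

Why a separate four-dimensional statement. (K) is recorded in `WightmanPermutedTube` for every
space dimension `d`, "like the sibling facts", but all sources (OS I, Jost, Streater–Wightman,
Tomozawa) are four-dimensional, and the printed route does not extend to all `d`: for `d = 1`,
`n = 3`, `σ = (0 1)` the open set `𝒯'₃ ∩ σ𝒯'₃` is non-empty, has no real points (totally space-like
triples in `1 + 1` dimensions are ordered chains) and its trace on `𝒯ʳ₃` has two components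
(`{λ ∈ ℂˣ | Im λ ≷ 0}` in the complex boost parameter), so neither Thm. 3-6 nor Tomozawa's
connectedness argument (which uses the normal forms of `L₊(ℂ) ≅ SL(2,ℂ) × SL(2,ℂ)/ℤ₂`,
Streater–Wightman (2-87)–(2-88)) says anything there; we know of no proof (or disproof) of (K) for
`d = 1`. (K₄) is (K) in the scope the sources cover; it is literally the instance `d = 3` of (K), so
every consequence of (K) drawn in the tree specializes verbatim.

## Sources

* Y. Tomozawa, *Local commutativity and the analytic continuation of the Wightman function*,
  J. Math. Phys. 4 (1963) 1240–1252, doi:10.1063/1.1703896: Abstract ("It is shown that the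
  extended tubes, the union of them and the intersection of any two are simply connected"); the
  text is paywalled and not held (acquisition requested), the statement below is the one of the
  abstract. [Tomozawa1963]
* K. Osterwalder, R. Schrader, *Axioms for Euclidean Green's functions*, Comm. Math. Phys. 31
  (1973) 83–112, §5 p. 97 (pdf p. 15). [OsterwalderSchraderCMP1973]
* R. F. Streater, A. S. Wightman, *PCT, Spin and Statistics, and All That*: §2-4, proof of the
  Lemma before Thm. 2-11, eqs. (2-87)–(2-90) (normal forms, pdf pp. 61–63); Fig. 2-4 (pdf
  pp. 66–67); Thm. 3-6 (pdf pp. 101–102). [StreaterWightman1964]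
* P. Kravchuk, J. Qiao, S. Rychkov, *Distributions in CFT II. Minkowski space*, JHEP 08 (2021)
  094, arXiv:2104.02090, §6.9 (local commutativity), footnote to Step 2: the single-valued extension to the
  permuted extended tube is referred to Jost's book App. II, Tomozawa (1963) and
  Bogolubov–Logunov–Oksak–Todorov §9.D. [KravchukQiaoRychkov2021]
* R. Jost, *The General Theory of Quantized Fields* (1965), p. 83 and App. II (not held;
  acq-00689). [Jost1965]

## Mathlib / tree

Used: `IsPreconnected.image`, `ContinuousLinearMap.continuous`; from the tree `PermReachable`,
`IsWightmanQFT.extendedTube_continuation_perm_eq_of_permReachable` (`WightmanPermutedTubeReach`),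
`exists_real_mem_relExtendedTube_perm` (`WightmanPermutedTubeLocal`), `diagAct`,
`lorentz_mem_relExtendedTube` (`WightmanAnalyticContinuation`), `relExtendedTube`,
`IsWightmanQFT.exists_symmetric_continuation_of_perm_eq`,
`IsWickRotationOf.schwinger_symmetric_of_perm_eq` (`WightmanPermutedTube`),
`IsWickRotationOf.schwinger_symmetric_of_four_facts` (`WightmanTubeInvariance`).

## Design choices

* (T) is recorded as connectedness (`IsConnected`, i.e. non-empty and preconnected) of
  `𝒯'ₙ ∩ σ𝒯'ₙ ⊆ (ℂ^{1+3})ⁿ` in point variables, for every `n` and every permutation `σ` of the `n`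
  points; the source states simple connectedness of the intersection of any two permuted extended
  tubes (in difference variables, an affine image), of which this is the part used. Non-emptiness
  is automatic in four dimensions (`exists_real_mem_relExtendedTube_perm`).
* (K₄) is *defined* as the instance `d = 3` of (K) rather than restated, so that
  `exists_symmetric_continuation_of_perm_eq`, `schwinger_symmetric_of_perm_eq`,
  `schwinger_symmetric_of_four_facts` apply to it without change.
-/

noncomputable section

open Set
open _root_.Topology

namespace Literature.MathematicalPhysics.QuantumLattice

variable {d : ℕ} {κ : Type*} {n : ℕ}

/-! ### Slices of the permuted extended tube on the relative tube -/

variable (d n) in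
/-- The **slice** of the permuted extended tube `σ𝒯'ₙ` on the relative forward tube:
`permSlice d n σ = {w ∈ 𝒯ʳₙ | w ∘ σ ∈ 𝒯'ₙ}`. Since `𝒯'ₙ = L₊(ℂ)𝒯ʳₙ` and `σ` commutes with the
diagonal action, `𝒯'ₙ ∩ σ𝒯'ₙ = L₊(ℂ) · permSlice d n σ`. [folklore] -/
def permSlice (σ : Equiv.Perm (Fin n)) : Set (Fin n → Fin (d + 1) → ℂ) :=
  {w | w ∈ QuantumFieldTheory.relForwardTube d n ∧ (fun k => w (σ k)) ∈ relExtendedTube d n}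

/-- Membership in the slice. [folklore] -/
theorem mem_permSlice_iff (σ : Equiv.Perm (Fin n)) (w : Fin n → Fin (d + 1) → ℂ) :
    w ∈ permSlice d n σ ↔
      w ∈ QuantumFieldTheory.relForwardTube d n ∧ (fun k => w (σ k)) ∈ relExtendedTube d n :=
  Iff.rfl

/-- The slice lies in the extended tube. [folklore] -/
theorem permSlice_subset_relExtendedTube (σ : Equiv.Perm (Fin n)) :
    permSlice d n σ ⊆ relExtendedTube d n :=
  fun _ hw => relForwardTube_subset_relExtendedTube hw.1

/-- If `z ∘ σ ∈ 𝒯'ₙ` then `(Λz) ∘ σ ∈ 𝒯'ₙ` for `Λ ∈ L₊(ℂ)` (the diagonal action commutes with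
permutations of the points). [folklore] -/
theorem perm_lorentz_mem_relExtendedTube {z : Fin n → Fin (d + 1) → ℂ} (σ : Equiv.Perm (Fin n))
    (hz : (fun k => z (σ k)) ∈ relExtendedTube d n)
    {Λ : (Fin (d + 1) → ℂ) ≃ₗ[ℂ] (Fin (d + 1) → ℂ)} (hΛ : Λ ∈ properComplexLorentzGroup d) :
    (fun k => (fun j => Λ (z j)) (σ k)) ∈ relExtendedTube d n :=
  lorentz_mem_relExtendedTube hz hΛ

/-- **Every point of `𝒯'ₙ ∩ σ𝒯'ₙ` is `Λ₀ w₀` with `Λ₀ ∈ L₊(ℂ)` and `w₀` in the slice.** [folklore] -/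
theorem exists_lorentz_permSlice_of_mem {z : Fin n → Fin (d + 1) → ℂ} (σ : Equiv.Perm (Fin n))
    (hz : z ∈ relExtendedTube d n) (hzσ : (fun k => z (σ k)) ∈ relExtendedTube d n) :
    ∃ Λ₀ ∈ properComplexLorentzGroup d, ∃ w₀ ∈ permSlice d n σ, z = fun k => Λ₀ (w₀ k) := by
  obtain ⟨Λ₀, hΛ₀, w₀, hw₀, rfl⟩ := hz
  refine ⟨Λ₀, hΛ₀, w₀, ⟨hw₀, ?_⟩, rfl⟩
  have h := lorentz_mem_relExtendedTube hzσ (Subgroup.inv_mem _ hΛ₀)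
  convert h using 1
  funext k
  simp

/-! ### Reachability from the preconnectedness of the slices -/

/-- **Reachability from preconnected slices.** If for every `σ ≠ 1` the slice
`{w ∈ 𝒯ʳₙ | w ∘ σ ∈ 𝒯'ₙ}` is preconnected and `𝒯'ₙ`, `σ𝒯'ₙ` have a real point in common, then
`PermReachable d n` holds: for `z = Λ₀w₀ ∈ 𝒯'ₙ ∩ σ𝒯'ₙ` the set `Λ₀ · permSlice d n σ` is a
preconnected subset of `𝒯'ₙ ∩ σ𝒯'ₙ` containing `z` and the point `Λ₀Λ₁⁻¹x` of the orbit of a common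
real point `x = Λ₁w₁`. [folklore] -/
theorem permReachable_of_isPreconnected_permSlice
    (hconn : ∀ σ : Equiv.Perm (Fin n), σ ≠ 1 → IsPreconnected (permSlice d n σ))
    (hreal : ∀ σ : Equiv.Perm (Fin n), σ ≠ 1 → ∃ x : Fin n → SpaceTime d,
      (fun k => complexifyPoint (x k)) ∈ relExtendedTube d n ∧
      (fun k => complexifyPoint (x (σ k))) ∈ relExtendedTube d n) :
    PermReachable d n := by
  intro σ hσ z hz hzσ
  obtain ⟨Λ₀, hΛ₀, w₀, hw₀, rfl⟩ := exists_lorentz_permSlice_of_mem σ hz hzσ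
  obtain ⟨x, hx, hxσ⟩ := hreal σ hσ
  obtain ⟨Λ₁, hΛ₁, w₁, hw₁, hxe⟩ := exists_lorentz_permSlice_of_mem σ hx hxσ
  refine ⟨diagAct d n Λ₀ '' permSlice d n σ,
    (hconn σ hσ).image _ (diagAct d n Λ₀).continuous.continuousOn, ?_, ?_, ?_,
    x, Λ₀ * Λ₁⁻¹, Subgroup.mul_mem _ hΛ₀ (Subgroup.inv_mem _ hΛ₁), hx, hxσ, ?_⟩
  · rintro _ ⟨w, hw, rfl⟩
    exact ⟨Λ₀, hΛ₀, w, hw.1, rfl⟩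
  · rintro _ ⟨w, hw, rfl⟩
    exact lorentz_mem_relExtendedTube hw.2 hΛ₀
  · exact ⟨w₀, hw₀, rfl⟩
  · refine ⟨w₁, hw₁, ?_⟩
    funext k
    have hk : complexifyPoint (x k) = Λ₁ (w₁ k) := congr_fun hxe k
    simp [hk, LinearEquiv.mul_apply]

/-- **Reachability from preconnected intersections.** If for every `σ ≠ 1` the open set
`𝒯'ₙ ∩ σ𝒯'ₙ` is preconnected and contains a real point, then `PermReachable d n` holds (take
`U = 𝒯'ₙ ∩ σ𝒯'ₙ` and `Λ = 1`). [folklore] -/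
theorem permReachable_of_isPreconnected_inter
    (hconn : ∀ σ : Equiv.Perm (Fin n), σ ≠ 1 →
      IsPreconnected (relExtendedTube d n ∩ {z | (fun k => z (σ k)) ∈ relExtendedTube d n}))
    (hreal : ∀ σ : Equiv.Perm (Fin n), σ ≠ 1 → ∃ x : Fin n → SpaceTime d,
      (fun k => complexifyPoint (x k)) ∈ relExtendedTube d n ∧
      (fun k => complexifyPoint (x (σ k))) ∈ relExtendedTube d n) :
    PermReachable d n := by
  intro σ hσ z hz hzσ
  obtain ⟨x, hx, hxσ⟩ := hreal σ hσ
  exact ⟨relExtendedTube d n ∩ {z | (fun k => z (σ k)) ∈ relExtendedTube d n}, hconn σ hσ,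
    inter_subset_left, fun w hw => hw.2, ⟨hz, hzσ⟩, x, 1, Subgroup.one_mem _, hx, hxσ,
    by simpa using (⟨hx, hxσ⟩ : (fun k => complexifyPoint (x k)) ∈
      relExtendedTube d n ∩ {z | (fun k => z (σ k)) ∈ relExtendedTube d n})⟩

/-! ### The named fact: Tomozawa's connectedness theorem (four space-time dimensions) -/

/-- **The intersection of two permuted extended tubes is connected** (Tomozawa (1963), Abstract:
"the analytic continuation of the Wightman function … due to local commutativity is proved
to be single-valued in the union of the extended tubes which correspond to the Wightman functions
obtained by permuting the order of the field operators in the product. It is shown that the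
extended tubes, the union of them and the intersection of any two are simply connected";
four-dimensional space-time). Recorded as the part used here, in point variables: for `d = 3`,
every `n` and every permutation `σ` of the `n` points, the open set `𝒯'ₙ ∩ σ𝒯'ₙ` of configurations
`z ∈ 𝒯'ₙ = relExtendedTube 3 n` with `z ∘ σ ∈ 𝒯'ₙ` is connected (the intersection of the permuted
extended tubes `𝒯'ₙ` and `σ⁻¹𝒯'ₙ`; it is non-empty, `exists_real_mem_relExtendedTube_perm`). The
printed proof rests on the normal forms of complex Lorentz transformations under
`L↑₊ × L↑₊` (Streater–Wightman (2-87)–(2-88)) and is specific to `L₊(ℂ)` in four dimensions; for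
`d = 1` the statement is false (`n = 3`, `σ = (0 1)`). Known theorem; proof deferred.
[cite: Tomozawa1963, Abstract] -/
def isConnected_relExtendedTube_inter_perm : Prop :=
  ∀ (n : ℕ) (σ : Equiv.Perm (Fin n)),
    IsConnected (relExtendedTube 3 n ∩ {z | (fun k => z (σ k)) ∈ relExtendedTube 3 n})

/-- **Reachability in four dimensions** from Tomozawa's theorem and the common real points of
Streater–Wightman Fig. 2-4 (`exists_real_mem_relExtendedTube_perm`). [folklore] -/
theorem permReachable_three (hT : isConnected_relExtendedTube_inter_perm) (n : ℕ) :
    PermReachable 3 n :=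
  permReachable_of_isPreconnected_inter (fun σ _ => (hT n σ).isPreconnected)
    fun σ _ => exists_real_mem_relExtendedTube_perm (m := 1) σ

/-! ### (K) in four space-time dimensions -/

/-- **The holomorphic Wightman function of one scalar field is single valued on the permuted
extended tube — four space-time dimensions** (Osterwalder–Schrader I (1973), §5, p. 97: "the
Wightman distribution `𝔚ₙ` is the boundary value of the Wightman function `Wₙ(z₁, …, zₙ)` which is
analytic, single valued, symmetric and `L₊(ℂ)` invariant for `(z₁, …, zₙ) ∈ S'ₙ`, see [Jost
(1965)], p. 83"; the global part by Tomozawa (1963)). This is the statement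
`IsWightmanQFT.extendedTube_continuation_perm_eq` of `WightmanPermutedTube` — for a Wightman QFT and
`n` copies of one hermitian scalar field, an analytic `L₊(ℂ)`-invariant `𝔚` on `𝒯'ₙ` with the
`n`-point Wightman distribution as boundary value satisfies `𝔚(z ∘ σ) = 𝔚(z)` whenever
`z, z ∘ σ ∈ 𝒯'ₙ` — *in the scope of the sources*, space dimension `d = 3`. The general-`d` recording
is not covered by any source: all printed proofs go through the real points common to `𝒯'ₙ` and
`σ𝒯'ₙ` and the connectedness of `𝒯'ₙ ∩ σ𝒯'ₙ`, and for `d = 1` (`n = 3`, `σ = (0 1)`) that set has no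
real points and is disconnected. Defined as the instance `d = 3` of the general statement, so that
its consequences in the tree specialize verbatim; it follows from Tomozawa's theorem
(`extendedTube_continuation_perm_eq_dim4_of_isConnected`). Known theorem; proof deferred.
[cite: OsterwalderSchraderCMP1973, §5 p. 97] -/
def IsWightmanQFT.extendedTube_continuation_perm_eq_dim4 : Prop :=
  IsWightmanQFT.extendedTube_continuation_perm_eq (d := 3) (κ := κ)

/-- (K₄) unfolds to the instance `d = 3` of (K). [folklore] -/
theorem IsWightmanQFT.extendedTube_continuation_perm_eq_dim4_iff :
    IsWightmanQFT.extendedTube_continuation_perm_eq_dim4 (κ := κ) ↔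
      IsWightmanQFT.extendedTube_continuation_perm_eq (d := 3) (κ := κ) :=
  Iff.rfl

/-- The general-dimension recording (K) implies its four-dimensional instance (K₄). [folklore] -/
theorem IsWightmanQFT.extendedTube_continuation_perm_eq_dim4_of_perm_eq
    (hK : ∀ d : ℕ, IsWightmanQFT.extendedTube_continuation_perm_eq (d := d) (κ := κ)) :
    IsWightmanQFT.extendedTube_continuation_perm_eq_dim4 (κ := κ) :=
  hK 3

/-- **Tomozawa's theorem implies (K₄).** The connectedness of the intersections `𝒯'ₙ ∩ σ𝒯'ₙ` in
four dimensions (`isConnected_relExtendedTube_inter_perm`), the common real points of S–W Fig. 2-4,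
Streater–Wightman Thm. 3-2 (d) and Thm. 3-6 (`WightmanLocality`, `WightmanPermutedTubeLocal`,
`WightmanPermutedTubeReach`) give the consistency of the Bargmann–Hall–Wightman continuation under
permutations in four space-time dimensions. [folklore] -/
theorem IsWightmanQFT.extendedTube_continuation_perm_eq_dim4_of_isConnected
    (hT : isConnected_relExtendedTube_inter_perm) :
    IsWightmanQFT.extendedTube_continuation_perm_eq_dim4 (κ := κ) :=
  IsWightmanQFT.extendedTube_continuation_perm_eq_of_permReachable (permReachable_three hT)

/-- **The symmetric continuation in four dimensions** from the Bargmann–Hall–Wightman continuation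
(A) (`IsWightmanQFT.exists_invariant_continuation`) and Tomozawa's theorem. [folklore] -/
theorem IsWightmanQFT.exists_symmetric_continuation_dim4_of_isConnected
    (hA : IsWightmanQFT.exists_invariant_continuation (d := 3) (κ := κ))
    (hT : isConnected_relExtendedTube_inter_perm) :
    IsWightmanQFT.exists_symmetric_continuation (d := 3) (κ := κ) :=
  IsWightmanQFT.exists_symmetric_continuation_of_perm_eq hA
    (IsWightmanQFT.extendedTube_continuation_perm_eq_dim4_of_isConnected hT)

/-- **Symmetry and real analyticity of the Schwinger functions in four dimensions** from (A) and
Tomozawa's theorem. [folklore] -/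
theorem IsWickRotationOf.schwinger_symmetric_dim4_of_isConnected
    (hA : IsWightmanQFT.exists_invariant_continuation (d := 3) (κ := κ))
    (hT : isConnected_relExtendedTube_inter_perm) :
    IsWickRotationOf.schwinger_symmetric (d := 3) (κ := κ) :=
  IsWickRotationOf.schwinger_symmetric_of_perm_eq hA
    (IsWightmanQFT.extendedTube_continuation_perm_eq_dim4_of_isConnected hT)

/-- **Symmetry and real analyticity of the Schwinger functions in four dimensions from four
classical facts**: the spectral condition (S–W Thm. 3-2 (b)), the Fourier–Laplace representation of
cone-supported distributions (Hörmander Thm. 7.4.2), the Bargmann–Hall–Wightman theorem (S–W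
Thm. 2-11) and Tomozawa's connectedness theorem. [folklore] -/
theorem IsWickRotationOf.schwinger_symmetric_dim4_of_four_facts
    (hb : ∀ W : WightmanData 3 κ, IsWightmanQFT.hasSpectralCondition_family (W := W))
    (hL : ∀ n : ℕ, Literature.Analysis.Distribution.fourierLaplace_coneSupport (Fin n × Fin (3 + 1)))
    (hB : ∀ m : ℕ, exists_extension_extendedForwardTube (d := 3) (n := m))
    (hT : isConnected_relExtendedTube_inter_perm) :
    IsWickRotationOf.schwinger_symmetric (d := 3) (κ := κ) :=
  IsWickRotationOf.schwinger_symmetric_of_four_facts hb hL hB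
    (IsWightmanQFT.extendedTube_continuation_perm_eq_dim4_of_isConnected hT)

end Literature.MathematicalPhysics.QuantumLattice
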